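import Summits.QuantumFields.BalabanUV.Beta.EriceRemainderEnclosureHistoryAutonomyComparisonDefectUniform
import Summits.QuantumFields.BalabanUV.Beta.EriceRemainderEnclosureHistoryAutonomyComparisonDefectAbove

/-!
# EriceRemainderEnclosureHistoryAutonomyComparisonDefectUniformEnclosure — (E140h) **ASYMPTOTICALLY EXACT ENCLOSURE OF A SIGN-FREE `ε`-REMAINDER: the levels of `h′` lie
# between those of the shifted structured flows up to the CONSTANT `c = 2(K−1)θε∕(1−θ)`, at every depth.**  The mirror of (E140g) (structured memory ABOVE an arbitrary
# functional: the level SURPLUS saturates at the memory length, `level_surplus_le_uniform` — (E140g)'s two sequence lemmas applied to `(−L, −X)`, the borrowing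
# inequality now read off (E140e)'s upper link) and the two-sided corollary: `B` isotone on `]0,γ]^ℕ` with zeroth moment `M`, floor `b`, `B ≤ β̄`, level-Lipschitz age
# profile `Λ` on `range K` over the box graded by `b − ε`, `θ = Σ_k k·Λ_k < 1`; `B′` ANY functional with **`|B′ − B| ≤ ε`** (`0 ≤ ε < b`); `h₋, h₊, h′` box solutions of
# `B − ε, B + ε, B′` from one pin.  Then for EVERY `j` (`enclosure_uniform`):
#     **`1∕h₋_j² − c ≤ 1∕h′_j² ≤ 1∕h₊_j² + c`,   `c = (K−1)·θ·2ε∕(1−θ)`**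
# — a constant level correction, against levels that grow at least like `j(b−ε)`: in coupling terms the enclosure `h₊ ≲ h′ ≲ h₋` holds up to factors
# `(1 ± c·h²)^{∓1∕2} → 1` in the ultraviolet ((E140g) `coupling_le_uniform` for the upper half).  Compare (E140f): factors `(1∓κ)^{∓1∕2}` CONSTANT in the depth; here the
# correction VANISHES in the depth.  Markov base (`K ≤ 1` or `θ = 0`): `c = 0`, the classical enclosure.

Cell `pub-balaban`, β-function sub-cell, BINDER row D4 «RemainderConst leaves for Bałaban's split» (`HOME/BINDER-OWNERS.md`; owner lineage `b2b-balaban-beta-an4`;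
this file by co-owner #2 lineage `b2b-balaban-beta-d4-p2`, generation 108), β-FLOW TEAM duty (1), FREEZE (0) honoured (def-free; (E140g) `lindley_lower` ∕ `interval_sum_lower`
∕ `level_deficit_le_uniform`, (E140e) `flow_link_upper_above` ∕ `dual_steps_above`, (E140f) `shift_mono` ∕ `shift_zm` ∕ `shift_profile` (re-proved inline, three lines each, to
keep the import light), (E138a) `base_level_gap_between`, (E48a) `family_zero` ∕ `family_succ_eq`, (E39), (E43b) BY NAME; nothing restated).

HONEST FRAMING (page 1, verbatim and binding).  *"Discharging BetaPertH makes Bałaban's UV stability UNCONDITIONAL — a real constructive-QFT result; it is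
NOT the continuum limit and NOT the Clay problem."*  THIS FILE DISCHARGES NOTHING OF THE KIND.  Elementary real analysis about ABSTRACT functionals on a box
]0,γ]^ℕ (node U2's `MemFlow` ∕ `SeqBox`) — hypotheses of a census, not facts: whether Bałaban's (1.22) limit functional splits as a structured part plus an `ε`-remainder
is NOT PRINTED ([I] p. 298; GAPS G-t4-U2-1∕-2) and NOT asserted.  Row D4 class UNCHANGED (critical-path width 0; instance 0∕1; D4 DISCHARGE NO DATE).  NOT B12 Thm 2, NOT
BetaPertH, NOT continuum YM, NOT Clay.

WHAT IS PROVED ([folklore]; 0 `def`, 0 sorry).  §1 `pos_part_le_window_above`, `level_rec_upper`, **`level_surplus_le_uniform`**.  §2 **`enclosure_uniform`**.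
-/

noncomputable section
open Finset Set

namespace Summit.QuantumFields.BalabanUV.Beta.EriceRemainderEnclosureHistoryAutonomyComparisonDefectUniformEnclosure

open Literature.MathematicalPhysics.QuantumFieldTheory.Balaban1983to89
open Literature.MathematicalPhysics.QuantumFieldTheory.Balaban1983to89.T4BetaStationary
open Literature.MathematicalPhysics.QuantumFieldTheory.Balaban1983to89.T4BetaFlowWellPosed
open Summit.QuantumFields.BalabanUV.Beta.EriceRemainderEnclosureHistoryAutonomyOrder (family_zero family_succ_eq)
open Summit.QuantumFields.BalabanUV.Beta.EriceRemainderEnclosureHistoryAutonomyComparisonDualContractionLinks (dual_step_eq_levels base_level_gap_between)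
open Summit.QuantumFields.BalabanUV.Beta.EriceRemainderEnclosureHistoryAutonomyComparisonDefectAbove (flow_link_upper_above dual_steps_above)
open Summit.QuantumFields.BalabanUV.Beta.EriceRemainderEnclosureHistoryAutonomyComparisonDefectUniform
  (lindley_lower interval_sum_lower level_deficit_le_uniform)

variable {B B' : (ℕ → ℝ) → ℝ} {M γ b : ℝ} {S : ℝ → ℕ → ℝ} {h h' hlo hup : ℕ → ℝ}

/-! ## §1 The mirror: the level surplus of an orbit below a structured memory saturates at the memory length -/

/-- **A POSITIVE DUAL STEP OF AN ORBIT BELOW THE STRUCTURED MEMORY BORROWS FROM THE NEGATIVE STEPS OF ITS WINDOW**: `X⁺_n ≤ Σ_{k<K} Λ_k Σ_{l<k} X⁻_{n+l+1}` — (E140e)'s upper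
link `X_n − E_n ≤ Σ_k Λ_k Σ_{l≤k} X⁻_{n+l}` with `E_n = (B′−B)(tail) ≤ 0` and, when `X_n > 0`, the `l = 0` terms absent. [folklore] -/
theorem pos_part_le_window_above {Λ : ℕ → ℝ} {K : ℕ} (hb : 0 < b)
    (hmono : ∀ u v : ℕ → ℝ, SeqBox γ u → SeqBox γ v → (∀ i, u i ≤ v i) → B u ≤ B v)
    (hB : ∀ u u' : ℕ → ℝ, SeqBox γ u → SeqBox γ u' → ∀ D : ℝ, (∀ j, |u j - u' j| ≤ D) → |B u - B u'| ≤ M * D) (hM : 0 ≤ M)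
    (hlo : ∀ u, SeqBox γ u → b ≤ B u) (hlo' : ∀ u, SeqBox γ u → b ≤ B' u) (hle : ∀ u, SeqBox γ u → B' u ≤ B u)
    (hS : ∀ p, 0 < p → p ≤ γ → SeqBox γ (S p) ∧ MemFlow B p (S p))
    (huniq : ∀ p, 0 < p → p ≤ γ → ∀ u u' : ℕ → ℝ, SeqBox γ u → SeqBox γ u' → MemFlow B p u → MemFlow B p u' → u = u')
    (hΛ : ∀ k, 0 ≤ Λ k)
    (hLip : ∀ u v : ℕ → ℝ, SeqBox γ u → SeqBox γ v → (∀ k : ℕ, 1 / γ ^ 2 + ((k : ℝ) + 1) * b ≤ 1 / u k ^ 2) →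
      (∀ k : ℕ, 1 / γ ^ 2 + ((k : ℝ) + 1) * b ≤ 1 / v k ^ 2) → B u - B v ≤ ∑ k ∈ range K, Λ k * max (1 / v k ^ 2 - 1 / u k ^ 2) 0)
    (hh' : SeqBox γ h') {y : ℝ} (hy : 0 < y) (hyγ : y ≤ γ) (hf' : MemFlow B' y h') (n : ℕ) :
    max (1 / h' (n + 1) ^ 2 - 1 / S (h' n) 1 ^ 2) 0
      ≤ ∑ k ∈ range K, Λ k * ∑ l ∈ range k, max (-(1 / h' (n + (l + 1) + 1) ^ 2 - 1 / S (h' (n + (l + 1))) 1 ^ 2)) 0 := by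
  have hlink := flow_link_upper_above hb hmono hB hM hlo hlo' hS huniq hΛ hLip hh' hy hyγ hf' n
  have hE0 : B' (fun i => h' (n + 1 + i)) - B (fun i => h' (n + 1 + i)) ≤ 0 := sub_nonpos.mpr (hle _ fun i => hh' (n + 1 + i))
  have hrhs0 : 0 ≤ ∑ k ∈ range K, Λ k * ∑ l ∈ range k, max (-(1 / h' (n + (l + 1) + 1) ^ 2 - 1 / S (h' (n + (l + 1))) 1 ^ 2)) 0 :=
    sum_nonneg fun k _ => mul_nonneg (hΛ k) (sum_nonneg fun l _ => le_max_right _ _)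
  by_cases hX : 1 / h' (n + 1) ^ 2 - 1 / S (h' n) 1 ^ 2 ≤ 0
  · rw [max_eq_right hX]; exact hrhs0
  · have hX' : 0 < 1 / h' (n + 1) ^ 2 - 1 / S (h' n) 1 ^ 2 := lt_of_not_ge hX
    rw [max_eq_left hX'.le]
    have hz : max (-(1 / h' (n + 0 + 1) ^ 2 - 1 / S (h' (n + 0)) 1 ^ 2)) 0 = 0 := by
      simp only [Nat.add_zero]; exact max_eq_right (by linarith)
    have hsplit : ∀ k ∈ range K, Λ k * ∑ l ∈ range (k + 1), max (-(1 / h' (n + l + 1) ^ 2 - 1 / S (h' (n + l)) 1 ^ 2)) 0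
        = Λ k * ∑ l ∈ range k, max (-(1 / h' (n + (l + 1) + 1) ^ 2 - 1 / S (h' (n + (l + 1))) 1 ^ 2)) 0 := by
      intro k _
      rw [sum_range_succ', hz, add_zero]
    rw [sum_congr rfl hsplit] at hlink
    linarith

/-- THE UPPER LINDLEY RECURSION OF THE LEVEL DIFFERENCE: `L_{j+1} ≤ X_j + max(L_j, 0)` for `L_j = 1∕h′_j² − 1∕(S y)_j²` ((E138a) `base_level_gap_between`, (E48a)
`family_succ_eq`). [folklore] -/
theorem level_rec_upper (hb : 0 < b)
    (hmono : ∀ u v : ℕ → ℝ, SeqBox γ u → SeqBox γ v → (∀ i, u i ≤ v i) → B u ≤ B v)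
    (hB : ∀ u u' : ℕ → ℝ, SeqBox γ u → SeqBox γ u' → ∀ D : ℝ, (∀ j, |u j - u' j| ≤ D) → |B u - B u'| ≤ M * D) (hM : 0 ≤ M)
    (hlo : ∀ u, SeqBox γ u → b ≤ B u)
    (hS : ∀ p, 0 < p → p ≤ γ → SeqBox γ (S p) ∧ MemFlow B p (S p))
    (huniq : ∀ p, 0 < p → p ≤ γ → ∀ u u' : ℕ → ℝ, SeqBox γ u → SeqBox γ u' → MemFlow B p u → MemFlow B p u' → u = u')
    (hh' : SeqBox γ h') {y : ℝ} (hy : 0 < y) (hyγ : y ≤ γ) (j : ℕ) :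
    1 / h' (j + 1) ^ 2 - 1 / S y (j + 1) ^ 2
      ≤ (1 / h' (j + 1) ^ 2 - 1 / S (h' j) 1 ^ 2) + max (1 / h' j ^ 2 - 1 / S y j ^ 2) 0 := by
  have hq := (hS y hy hyγ).1 j
  have hgap := (base_level_gap_between hb hmono hB hM hlo hS huniq (hh' j).1 (hh' j).2 hq.1 hq.2 1).1
  rw [← family_succ_eq hS huniq hy hyγ j] at hgap
  linarith

/-- **THE LEVEL SURPLUS OF AN ORBIT BELOW A STRUCTURED MEMORY SATURATES: `1∕h′_j² ≤ 1∕h_j² + (K−1)·θδ∕(1−θ)` UNIFORMLY IN `j`.**  `B`: isotone on `]0,γ]^ℕ`, zeroth moment `M`,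
`B ≤ β̄`, level-Lipschitz age profile `Λ ≥ 0` on `range K` over the graded box (grading `b`), `θ = Σ_{k<K} k·Λ_k < 1`.  `B′`: ANY functional with `b ≤ B′ ≤ B` (`b > 0`)
whose deficit `D = B − B′` satisfies `u ≤ v ⟹ D u ≤ (1+τ)·D v + δ` (`τ, δ ≥ 0`), `(1+τ)θ ≤ 1`.  `h, h′`: ANY box solutions of `B, B′` from one pin.  ((E140e)
`level_surplus_le` had `j·θδ∕(1−θ)`.) [folklore] -/
theorem level_surplus_le_uniform {Λ : ℕ → ℝ} {K : ℕ} {βb p τ δ : ℝ}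
    (hmono : ∀ u v : ℕ → ℝ, SeqBox γ u → SeqBox γ v → (∀ i, u i ≤ v i) → B u ≤ B v)
    (hB : ∀ u u' : ℕ → ℝ, SeqBox γ u → SeqBox γ u' → ∀ D : ℝ, (∀ j, |u j - u' j| ≤ D) → |B u - B u'| ≤ M * D) (hM : 0 ≤ M)
    (hb : 0 < b) (hlo' : ∀ u, SeqBox γ u → b ≤ B' u) (hle : ∀ u, SeqBox γ u → B' u ≤ B u) (hbdd : ∀ u, SeqBox γ u → B u ≤ βb)
    (hΛ : ∀ k, 0 ≤ Λ k) (hθ : ∑ k ∈ range K, (k : ℝ) * Λ k < 1)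
    (hτ : 0 ≤ τ) (hθτ : (1 + τ) * ∑ k ∈ range K, (k : ℝ) * Λ k ≤ 1) (hδ : 0 ≤ δ)
    (hLip : ∀ u v : ℕ → ℝ, SeqBox γ u → SeqBox γ v → (∀ k : ℕ, 1 / γ ^ 2 + ((k : ℝ) + 1) * b ≤ 1 / u k ^ 2) →
      (∀ k : ℕ, 1 / γ ^ 2 + ((k : ℝ) + 1) * b ≤ 1 / v k ^ 2) → B u - B v ≤ ∑ k ∈ range K, Λ k * max (1 / v k ^ 2 - 1 / u k ^ 2) 0)
    (hDdef : ∀ u v : ℕ → ℝ, SeqBox γ u → SeqBox γ v → (∀ i, u i ≤ v i) → B u - B' u ≤ (1 + τ) * (B v - B' v) + δ)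
    (hp : 0 < p) (hpγ : p ≤ γ) (hh : SeqBox γ h) (hf : MemFlow B p h) (hh' : SeqBox γ h') (hf' : MemFlow B' p h') (j : ℕ) :
    1 / h' j ^ 2 ≤ 1 / h j ^ 2 + ((K - 1 : ℕ) : ℝ) * ((∑ k ∈ range K, (k : ℝ) * Λ k) * δ / (1 - ∑ k ∈ range K, (k : ℝ) * Λ k)) := by
  set F : ℝ := (∑ k ∈ range K, (k : ℝ) * Λ k) * δ / (1 - ∑ k ∈ range K, (k : ℝ) * Λ k) with hFdef
  have hlo : ∀ u, SeqBox γ u → b ≤ B u := fun u hu => (hlo' u hu).trans (hle u hu)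
  -- the unique base family
  have hex : ∀ q : ℝ, 0 < q → q ≤ γ → ∃ k : ℕ → ℝ, SeqBox γ k ∧ MemFlow B q k :=
    fun q hq hqγ => Summit.QuantumFields.BalabanUV.Beta.EriceRemainderEnclosureHistoryAutonomyExistence.exists_memFlow_zm hB hM hq hqγ hb hlo
  choose! S hSb hSf using hex
  have hS : ∀ q, 0 < q → q ≤ γ → SeqBox γ (S q) ∧ MemFlow B q (S q) := fun q hq hqγ => ⟨hSb q hq hqγ, hSf q hq hqγ⟩
  have huniq : ∀ q, 0 < q → q ≤ γ → ∀ u u' : ℕ → ℝ, SeqBox γ u → SeqBox γ u' → MemFlow B q u → MemFlow B q u' → u = u' :=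
    fun q hq _ u u' hu hu' hfu hfu' =>
      Summit.QuantumFields.BalabanUV.Beta.EriceRemainderEnclosureHistoryAutonomyMonotoneGeneral.memFlow_unique_of_monotone_zm
        hmono hB hM hq hb hlo hu hu' hfu hfu'
  have e : h = S p := huniq p hp hpγ _ _ hh (hS p hp hpγ).1 hf (hS p hp hpγ).2
  have hθ0 : 0 ≤ ∑ k ∈ range K, (k : ℝ) * Λ k := sum_nonneg fun k _ => mul_nonneg (Nat.cast_nonneg k) (hΛ k)
  have hF0 : 0 ≤ F := div_nonneg (mul_nonneg hθ0 hδ) (by linarith)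
  -- Lindley for (−L, −X)
  have key := lindley_lower (L := fun j => -(1 / h' j ^ 2 - 1 / S p j ^ 2)) (X := fun m => -(1 / h' (m + 1) ^ 2 - 1 / S (h' m) 1 ^ 2))
    (C := ((K - 1 : ℕ) : ℝ) * F)
    (by show 0 ≤ -(1 / h' 0 ^ 2 - 1 / S p 0 ^ 2); rw [hf'.1, family_zero hS hp hpγ]; simp)
    (fun j => by
      have hr := level_rec_upper hb hmono hB hM hlo hS huniq hh' hp hpγ j
      have e1 : min (-(1 / h' j ^ 2 - 1 / S p j ^ 2)) 0 = -max (1 / h' j ^ 2 - 1 / S p j ^ 2) 0 := by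
        rcases le_total (1 / h' j ^ 2 - 1 / S p j ^ 2) 0 with hx | hx
        · rw [max_eq_right hx, min_eq_right (by linarith), neg_zero]
        · rw [max_eq_left hx, min_eq_left (by linarith)]
      show -(1 / h' (j + 1) ^ 2 - 1 / S (h' j) 1 ^ 2) + min (-(1 / h' j ^ 2 - 1 / S p j ^ 2)) 0 ≤ -(1 / h' (j + 1) ^ 2 - 1 / S p (j + 1) ^ 2)
      rw [e1]
      linarith)
    (fun i t => by
      have hint := interval_sum_lower (X := fun m => -(1 / h' (m + 1) ^ 2 - 1 / S (h' m) 1 ^ 2)) hΛ hθ.le hF0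
        (fun n => by
          have := (dual_steps_above hb hmono hB hM hlo' hle hbdd hS huniq hΛ hθ hτ hθτ hδ hLip hDdef hh' hp hpγ hf' n).1
          show -F ≤ -(1 / h' (n + 1) ^ 2 - 1 / S (h' n) 1 ^ 2)
          linarith)
        (fun n => by
          have hw := pos_part_le_window_above hb hmono hB hM hlo hlo' hle hS huniq hΛ hLip hh' hp hpγ hf' n
          have e2 : max (-(-(1 / h' (n + 1) ^ 2 - 1 / S (h' n) 1 ^ 2))) 0 = max (1 / h' (n + 1) ^ 2 - 1 / S (h' n) 1 ^ 2) 0 := by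
            rw [neg_neg]
          show max (-(-(1 / h' (n + 1) ^ 2 - 1 / S (h' n) 1 ^ 2))) 0 ≤
            ∑ k ∈ range K, Λ k * ∑ l ∈ range k, max (-(1 / h' (n + (l + 1) + 1) ^ 2 - 1 / S (h' (n + (l + 1))) 1 ^ 2)) 0
          rw [e2]
          exact hw) i t
      exact hint) j
  have key' : -(((K - 1 : ℕ) : ℝ) * F) ≤ -(1 / h' j ^ 2 - 1 / S p j ^ 2) := key
  rw [e]
  linarith

/-! ## §2 The uniform two-sided enclosure of a sign-free `ε`-remainder -/

/-- **ASYMPTOTICALLY EXACT ENCLOSURE.**  `B`: isotone on the box `]0,γ]^ℕ`, zeroth moment `M`, floor `b`, `B ≤ β̄`, level-Lipschitz age profile `Λ ≥ 0` on `range K` over the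
box graded by `b − ε` (`B u − B v ≤ Σ_{k<K} Λ_k·(1∕v_k² − 1∕u_k²)⁺` when the age-`k` levels are `≥ 1∕γ² + (k+1)(b−ε)`), `θ := Σ_{k<K} k·Λ_k < 1`.  `B′`: ANY functional with
**`|B′ u − B u| ≤ ε`** on the box, `0 ≤ ε < b`.  `h₋, h₊, h′`: ANY box solutions of `B − ε`, `B + ε`, `B′` from one pin `p`.  Then with **`c := (K−1)·θ·2ε∕(1−θ)`**, at EVERY
scale `j`:   **`1∕h₋_j² − c ≤ 1∕h′_j² ≤ 1∕h₊_j² + c`**  — a DEPTH-INDEPENDENT level correction ((E140g) `level_deficit_le_uniform` over the base `B − ε` with the sign-free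
excess `B′ − B + ε ∈ [0,2ε]`; `level_surplus_le_uniform` under the top `B + ε` with the deficit `B + ε − B′ ∈ [0,2ε]`; both `τ = 0`, `δ = 2ε`). [folklore] -/
theorem enclosure_uniform {Λ : ℕ → ℝ} {K : ℕ} {βb p ε : ℝ}
    (hmono : ∀ u v : ℕ → ℝ, SeqBox γ u → SeqBox γ v → (∀ i, u i ≤ v i) → B u ≤ B v)
    (hB : ∀ u u' : ℕ → ℝ, SeqBox γ u → SeqBox γ u' → ∀ D : ℝ, (∀ j, |u j - u' j| ≤ D) → |B u - B u'| ≤ M * D) (hM : 0 ≤ M)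
    (hε : 0 ≤ ε) (hεb : ε < b) (hlow : ∀ u, SeqBox γ u → b ≤ B u) (hbdd : ∀ u, SeqBox γ u → B u ≤ βb)
    (hΛ : ∀ k, 0 ≤ Λ k) (hθ : ∑ k ∈ range K, (k : ℝ) * Λ k < 1)
    (hLip : ∀ u v : ℕ → ℝ, SeqBox γ u → SeqBox γ v → (∀ k : ℕ, 1 / γ ^ 2 + ((k : ℝ) + 1) * (b - ε) ≤ 1 / u k ^ 2) →
      (∀ k : ℕ, 1 / γ ^ 2 + ((k : ℝ) + 1) * (b - ε) ≤ 1 / v k ^ 2) → B u - B v ≤ ∑ k ∈ range K, Λ k * max (1 / v k ^ 2 - 1 / u k ^ 2) 0)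
    (hpert : ∀ u, SeqBox γ u → |B' u - B u| ≤ ε)
    (hp : 0 < p) (hpγ : p ≤ γ) (hhlo : SeqBox γ hlo) (hflo : MemFlow (fun w => B w + -ε) p hlo)
    (hhup : SeqBox γ hup) (hfup : MemFlow (fun w => B w + ε) p hup) (hh' : SeqBox γ h') (hf' : MemFlow B' p h') (j : ℕ) :
    1 / hlo j ^ 2 - ((K - 1 : ℕ) : ℝ) * ((∑ k ∈ range K, (k : ℝ) * Λ k) * (2 * ε) / (1 - ∑ k ∈ range K, (k : ℝ) * Λ k)) ≤ 1 / h' j ^ 2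
      ∧ 1 / h' j ^ 2 ≤ 1 / hup j ^ 2 + ((K - 1 : ℕ) : ℝ) * ((∑ k ∈ range K, (k : ℝ) * Λ k) * (2 * ε) / (1 - ∑ k ∈ range K, (k : ℝ) * Λ k)) := by
  have hb0 : 0 < b - ε := by linarith
  have hε2 : 0 ≤ 2 * ε := by linarith
  have hθ0 : 0 ≤ ∑ k ∈ range K, (k : ℝ) * Λ k := sum_nonneg fun k _ => mul_nonneg (Nat.cast_nonneg k) (hΛ k)
  have hθτ : (1 + (0 : ℝ)) * ∑ k ∈ range K, (k : ℝ) * Λ k ≤ 1 := by linarith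
  -- structure of the shifted memories
  have hmono_s : ∀ c : ℝ, ∀ u v : ℕ → ℝ, SeqBox γ u → SeqBox γ v → (∀ i, u i ≤ v i) → (fun w => B w + c) u ≤ (fun w => B w + c) v :=
    fun c u v hu hv huv => by show B u + c ≤ B v + c; linarith [hmono u v hu hv huv]
  have hzm_s : ∀ c : ℝ, ∀ u u' : ℕ → ℝ, SeqBox γ u → SeqBox γ u' → ∀ D : ℝ, (∀ j, |u j - u' j| ≤ D) →
      |(fun w => B w + c) u - (fun w => B w + c) u'| ≤ M * D := fun c u u' hu hu' D hD => by
    show |B u + c - (B u' + c)| ≤ M * D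
    rw [show B u + c - (B u' + c) = B u - B u' by ring]
    exact hB u u' hu hu' D hD
  have hLip_s : ∀ c : ℝ, ∀ u v : ℕ → ℝ, SeqBox γ u → SeqBox γ v → (∀ k : ℕ, 1 / γ ^ 2 + ((k : ℝ) + 1) * (b - ε) ≤ 1 / u k ^ 2) →
      (∀ k : ℕ, 1 / γ ^ 2 + ((k : ℝ) + 1) * (b - ε) ≤ 1 / v k ^ 2) →
      (fun w => B w + c) u - (fun w => B w + c) v ≤ ∑ k ∈ range K, Λ k * max (1 / v k ^ 2 - 1 / u k ^ 2) 0 :=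
    fun c u v hu hv hgu hgv => by
      show B u + c - (B v + c) ≤ _
      rw [show B u + c - (B v + c) = B u - B v by ring]
      exact hLip u v hu hv hgu hgv
  constructor
  · -- lower half of the levels: base B − ε below B′, excess in [0, 2ε]
    have hlo0 : ∀ u, SeqBox γ u → b - ε ≤ (fun w => B w + -ε) u := fun u hu => by
      show b - ε ≤ B u + -ε; linarith [hlow u hu]
    have hexc : ∀ u, SeqBox γ u → (fun w => B w + -ε) u ≤ B' u := fun u hu => by
      show B u + -ε ≤ B' u; linarith [(abs_le.mp (hpert u hu)).1]
    have hbdd' : ∀ u, SeqBox γ u → B' u ≤ βb + ε := fun u hu => by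
      linarith [(abs_le.mp (hpert u hu)).2, hbdd u hu]
    have hDosc : ∀ u v : ℕ → ℝ, SeqBox γ u → SeqBox γ v → (∀ i, u i ≤ v i) →
        B' u - (fun w => B w + -ε) u ≤ (1 + (0 : ℝ)) * (B' v - (fun w => B w + -ε) v) + 2 * ε := fun u v hu hv _ => by
      show B' u - (B u + -ε) ≤ (1 + 0) * (B' v - (B v + -ε)) + 2 * ε
      linarith [(abs_le.mp (hpert u hu)).2, (abs_le.mp (hpert v hv)).1]
    exact level_deficit_le_uniform (B := fun w => B w + -ε) (B' := B') (hmono_s (-ε)) (hzm_s (-ε)) hM hb0 hlo0 hΛ hθ le_rfl hθτ hε2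
      (hLip_s (-ε)) hexc hbdd' hDosc hp hpγ hhlo hflo hh' hf' j
  · -- upper half of the levels: top B + ε above B′, deficit in [0, 2ε], common floor b − ε
    have hlo' : ∀ u, SeqBox γ u → b - ε ≤ B' u := fun u hu => by
      linarith [(abs_le.mp (hpert u hu)).1, hlow u hu]
    have hle : ∀ u, SeqBox γ u → B' u ≤ (fun w => B w + ε) u := fun u hu => by
      show B' u ≤ B u + ε; linarith [(abs_le.mp (hpert u hu)).2]
    have hbdd' : ∀ u, SeqBox γ u → (fun w => B w + ε) u ≤ βb + ε := fun u hu => by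
      show B u + ε ≤ βb + ε; linarith [hbdd u hu]
    have hDdef : ∀ u v : ℕ → ℝ, SeqBox γ u → SeqBox γ v → (∀ i, u i ≤ v i) →
        (fun w => B w + ε) u - B' u ≤ (1 + (0 : ℝ)) * ((fun w => B w + ε) v - B' v) + 2 * ε := fun u v hu hv _ => by
      show B u + ε - B' u ≤ (1 + 0) * (B v + ε - B' v) + 2 * ε
      linarith [(abs_le.mp (hpert u hu)).1, (abs_le.mp (hpert v hv)).2]
    exact level_surplus_le_uniform (B := fun w => B w + ε) (B' := B') (hmono_s ε) (hzm_s ε) hM hb0 hlo' hle hbdd' hΛ hθ le_rfl hθτ hε2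
      (hLip_s ε) hDdef hp hpγ hhup hfup hh' hf' j

end Summit.QuantumFields.BalabanUV.Beta.EriceRemainderEnclosureHistoryAutonomyComparisonDefectUniformEnclosure

end
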